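import Literature.Probability.RandomPlanarGeometry.HexSAWStripWidthTwoContactCLT
import HarnessLib

/-!
# The width-two strip at criticality: ALL MOMENTS of the standardised surface-contact count converge to the Gaussian moments
# (module «WIDTH-TWO CONTACT MOMENTS»; corollary of «WIDTH-TWO CONTACT CLT» via Curtiss' moment theorem)

Topic `Literature/Probability/RandomPlanarGeometry` (continues «WIDTH-TWO CONTACT CLT» — `W2.contactLawStepTwo`, `W2.tendsto_contactMGFStepTwo`,
`W2.integral_exp_mul_contactLawStepTwo`, `W2.varRateHat_pos` — with the Moments file's `tendsto_integral_pow_of_tendsto_mgf` (J. H. Curtiss 1942, Theorem 2/3: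
mgf convergence on a neighbourhood of `0` ⟹ convergence of every moment) and Mathlib's `mgf_id_gaussianReal`, `integrable_exp_mul_gaussianReal`,
`integral_id_gaussianReal`).  Lane «pcv-sawmu» (CriticalPhenomena venture), a-p2 g27.  Nothing below is printed.

## What is proved (namespace `…SAW.HV.W2`; `θ₂ = (3 − √2)/4`, `σ₂² = (96 − 67√2)/8`, `n = hatLen k a b`)
* `integral_pow_contactLawStepTwo` — the `m`-th moment written as the finite weighted sum over the bridges.
* ★★★ `tendsto_moment_contactLawStepTwo (a b) (m)` — `E[((#top − θ₂n)/√n)^m] → ∫ x^m dN(0, σ₂²)` for EVERY `m` and all end levels.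
* ★ `tendsto_first_moment_contactLawStepTwo` — the case `m = 1`: `→ 0`.

Label: LANE THEOREM (own result of lane «pcv-sawmu», a-p2 g27, 2026-08-28; not in print).  NOT claimed: closed forms `σ₂^{2j}(2j−1)!!` of the Gaussian moments
(Mathlib has the variance; higher ones are left as the Gaussian integrals), rates of convergence.
-/

noncomputable section

open Finset Filter Topology Matrix MeasureTheory ProbabilityTheory Literature.Probability.LatticeModels Literature.Probability.Percolation Literature.Analysis
open Literature.Probability.Moments

namespace Literature.Probability.RandomPlanarGeometry.SAW

namespace HV

namespace W2

/-! ## All moments of the standardised contact count converge to the Gaussian moments -/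

/-- The `m`-th moment of `(#top − θ₂n)/√n` under the critical weights, written out: `Σ_l (wD l/D̂)·((#top(l) − θ₂n)/√n)^m` (when `D̂ ≠ 0`).
[cite: Durrett2019, §3.2; lane plumbing] -/
theorem integral_pow_contactLawStepTwo {k : ℕ} {a b : Fin (2 * 2)} (h : hatD 2 (stripYT 2) k a b ≠ 0) (m : ℕ) :
    ∫ x, x ^ m ∂contactLawStepTwo k a b =
      ∑ l ∈ LUset 2 (2 * k + 1) (hatLen k a b) (a : ℕ) (b : ℕ), wD 2 (stripYT 2) l / hatD 2 (stripYT 2) k a b *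
        (((topCnt 2 l.tail : ℝ) - (3 - Real.sqrt 2) / 4 * ((hatLen k a b : ℤ) : ℝ)) / Real.sqrt ((hatLen k a b : ℤ) : ℝ)) ^ m := by
  rw [contactLawStepTwo, if_neg h, HexBW.WidthOneYZ.integral_finLaw _ _ (wD_div_hatD_nonneg k a b)]

/-- ★★★ **CONVERGENCE OF ALL MOMENTS** (Curtiss' moment theorem, `Literature.Probability.Moments.tendsto_integral_pow_of_tendsto_mgf`): for all `a, b` and every
`m`, the `m`-th moment of `(#top − θ₂n)/√n` under the critical weights on the bridges `a → b` of hat index `k+1` converges to the `m`-th moment of `N(0, σ₂²)`,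
`σ₂² = (96 − 67√2)/8` — in particular the standardised mean `→ 0` and (m = 2) the variance per step `→ σ₂²`, recovering «WIDTH-TWO CONTACT VARIANCE RATE»
in the step normalisation, and the skewness/kurtosis are asymptotically Gaussian.
[cite: Feller1968, XIII.6; Durrett2019, §3.2; lane «pcv-sawmu» a-p2 g27 — own result, not in print] -/
theorem tendsto_moment_contactLawStepTwo (a b : Fin (2 * 2)) (m : ℕ) :
    Tendsto (fun k : ℕ => ∫ x, x ^ m ∂contactLawStepTwo (k + 1) a b) atTop
      (𝓝 (∫ x, x ^ m ∂gaussianReal 0 ((96 - 67 * Real.sqrt 2) / 8).toNNReal)) := by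
  have hσ : 0 < (96 - 67 * Real.sqrt 2) / 8 := by linarith [varRateHat_pos]
  have hA : 0 < limTwo a b := limTwo_pos a b
  have hev : ∀ᶠ k : ℕ in atTop, hatD 2 (stripYT 2) (k + 1) a b ≠ 0 :=
    ((tendsto_hatD_two a b).comp (tendsto_add_atTop_nat 1)).eventually_ne hA.ne'
  refine tendsto_integral_pow_of_tendsto_mgf (μ := fun k => contactLawStepTwo (k + 1) a b) (ν := gaussianReal 0 ((96 - 67 * Real.sqrt 2) / 8).toNNReal)
    one_pos (fun s _ k => ?_) (fun s _ => integrable_exp_mul_gaussianReal s) (fun s _ => ?_) m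
  · rw [contactLawStepTwo]
    split_ifs
    · exact integrable_dirac (by simp)
    · exact HexBW.WidthOneYZ.integrable_finLaw _ _ _ _
  · have h := tendsto_contactMGFStepTwo a b s
    have hG : ∫ x, Real.exp (s * x) ∂gaussianReal 0 ((96 - 67 * Real.sqrt 2) / 8).toNNReal = Real.exp ((96 - 67 * Real.sqrt 2) / 8 * s ^ 2 / 2) := by
      have hm := congrFun (mgf_id_gaussianReal (μ := 0) (v := ((96 - 67 * Real.sqrt 2) / 8).toNNReal)) s
      simp only [mgf, id] at hm
      rw [hm, Real.coe_toNNReal _ hσ.le]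
      ring_nf
    rw [hG]
    refine h.congr' ?_
    filter_upwards [hev] with k hk
    rw [integral_exp_mul_contactLawStepTwo hk]

/-- ★ The first moment: `E[(#top − θ₂n)/√n] → 0` (the centring `θ₂n` is correct to `o(√n)`; indeed to `O(1)`, «CONTACT VARIANCE RATE» `tendsto_meanTopTwo_sub_linear`).
[cite: Feller1968, XIII.6; lane «pcv-sawmu» a-p2 g27] -/
theorem tendsto_first_moment_contactLawStepTwo (a b : Fin (2 * 2)) :
    Tendsto (fun k : ℕ => ∫ x, x ∂contactLawStepTwo (k + 1) a b) atTop (𝓝 0) := by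
  have h := tendsto_moment_contactLawStepTwo a b 1
  simp only [pow_one] at h
  rwa [integral_id_gaussianReal] at h

end W2

end HV

end Literature.Probability.RandomPlanarGeometry.SAW
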